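import Literature.Analysis.FluidPDE.AncientMildGaugeFixing
import Literature.Analysis.FluidPDE.KNSSLineInvariantLiouville
import Literature.Analysis.FluidPDE.LeiRenZhang2019SlidingVelocity
import Summits.NavierStokesRegularity.NavierStokesRegularity.Theorems.ScenarioCensusAncientSymmetry
import HarnessLib

/-!
# Blow-up scenario census, block A: row A7 (bounded 2.5D ancient mild solutions) is EXCLUDED-IN-TREE

Cell `pub/ns-census` (director-ns KEY req102, D-0154 (A), 2026-08-28), typer seat `ns-census-typer-2`
(generation 4). Companion of `ScenarioCensusAncientSymmetry.lean`, whose Appendix 3 TYPED census row A7 —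
(any bounded type · 2.5D: `u(t, x + δ e₃) = u(t, x)` for all `δ` · bounded ancient mild solution in the
tree's duality form, `ν = 1`, measurable slices) ⇒ every slice is a.e. constant — as
`Row_A7`, with the value EXCLUDED-IN-PRINT-NOT-TREE ("the 3D-mild → 2D-weak bridge is not in the tree for
this class"). This file PROVES it, `row_A7_excluded : Row_A7`, so the cell becomes EXCLUDED-IN-TREE.

The tree already holds the Liouville theorem for `2½`-dimensional bounded ancient mild solutions which are
JOINTLY CONTINUOUS on `(−∞, 0) × ℝ³` (`FluidPDE.ae_eq_const_of_invariant_along`,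
`KNSSLineInvariantLiouville.lean`, whose docstring lists the measurable-slice class as "NOT here"). The
duality-form class of the census rows asks only for measurable slices and contains the images of print's
bounded weak solutions under a possibly non-measurable spatially constant drift (KNSS 2009, §1 p. 3). The
proof below removes the continuity hypothesis by composing DISCHARGED tree theorems:

1. gauge fixing (`IsBoundedAncientMildSolution.exists_stronglyMeasurable_gauge`, `AncientMildGaugeFixing`):
   `u` agrees slice-wise a.e., modulo spatial constants `d(t)`, with a jointly measurable member `ũ` of the
   class, which is a bounded weak solution in the sense of KNSS §4 (ii)
   (`IsBoundedAncientMildSolution.isBoundedWeakNSSolutionOn`);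
2. the §4 representative `ũ = U + b(t)` a.e. (`KNSS2009_regularity_boundedWeak_ancient_holds`): `U` smooth
   in `x` with bounded derivatives, Lipschitz in `t` from order one on, `b` bounded measurable; at a.e.
   `t` the slice `U(t, ·)` inherits the invariance everywhere (continuity);
3. after modifying `U` on a measurable null set of times (the bounded weak class only sees `u` a.e.,
   `IsBoundedWeakNSSolutionOn.congr_ae`), the slice-continuous descent lemma
   (`IsBoundedWeakNSSolutionOn.planarProj_trace_of_lineInvariant`) and KNSS Theorem 5.1
   (`KNSS2009_liouville_planar_holds`) make the planar components of `U(t, ·)` constant in space for a.e.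
   `t`, and the Lipschitz continuity in `t` of `∇U` upgrades this to every `t < 0`;
4. `repr_const_of_planar_const` (Lemma 2.1 on the vorticity components and incompressibility,
   `KNSSLineInvariantVorticity`) makes `U(t, ·)` constant in space at every `t < 0`;
5. hence a.e. slice of `u` is a.e. constant, and the continuity of the solenoidal pairings upgrades this to
   every `t < 0` (`IsBoundedAncientMildSolution.exists_ae_eq_const_slice`);
6. the invariant direction is moved from the Lean coordinate `1` to an arbitrary `e ≠ 0` (census A7:
   `e = e₃`) by conjugating with a reflection (`IsBoundedAncientMildSolution.conj_linearIsometryEquiv`), as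
   in `apply_eq_apply_zero_of_invariant_along`.

No summit statement is proved or claimed here; nothing in this file is a claim about Navier–Stokes
regularity. (Row A7 is the degenerate `2½`-dimensional special case of the Liouville conjecture (L),
census row A1, which stays OPEN.)

References: G. Koch, N. Nadirashvili, G. Seregin, V. Šverák, Acta Math. 203 (2009) 83–105 =
arXiv:0709.3599, Thm 5.1 (p. 9), §4 (p. 8), Lemma 2.1 (p. 5), §1 p. 3, proof of Thm 6.2 (p. 13);
A. J. Majda, A. L. Bertozzi, *Vorticity and Incompressible Flow*, CUP 2002, §2.3.1.
-/

noncomputable section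

set_option linter.dupNamespace false

open MeasureTheory Set Function Filter Topology WithLp
open scoped RealInnerProductSpace ContDiff

namespace Summit.NavierStokesRegularity.NavierStokesRegularity.Theorems.ScenarioCensus

open Literature.Analysis Literature.Analysis.FluidPDE

/-! ## The Liouville theorem for line-invariant bounded ancient mild solutions with measurable slices -/

/-- A point of `ℝ³` is its trace on the plane `x₁ = 0` plus its `e₁`-component. -/
private theorem eq_planarPoint_add_single_census (x : EuclideanSpace ℝ (Fin 3)) :
    x = (toLp 2 ![x 0, 0, x 2] : EuclideanSpace ℝ (Fin 3)) + EuclideanSpace.single 1 (x 1) := by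
  ext j
  fin_cases j <;> simp

/-- **Liouville theorem for `2½`-dimensional bounded ancient mild solutions, measurable-slice class**
(KNSS 2009, Theorem 5.1 with §4 and Lemma 2.1; cf. the proof of Theorem 6.2, arXiv p. 13, and
Majda–Bertozzi §2.3.1). Let `u` be a bounded ancient mild solution of Navier–Stokes (`ν = 1`, duality form
`IsBoundedAncientMildSolution 1 u`) with a.e.-strongly measurable slices, invariant under the translations
`x ↦ x + δe₁` along the Lean coordinate `1` at every `t < 0`. Then every slice `u(t, ·)`, `t < 0`, is
a.e. equal to a constant. (The jointly continuous case is `FluidPDE.ae_eq_const_of_lineInvariant`; here the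
continuity is removed by gauge fixing, the §4 representative, a modification on a null set of times, the
slice-continuous descent lemma and the continuity of the solenoidal pairings — see the module docstring.) -/
theorem ae_eq_const_of_lineInvariant_of_measurable
    {u : ℝ → EuclideanSpace ℝ (Fin 3) → EuclideanSpace ℝ (Fin 3)}
    (hu : IsBoundedAncientMildSolution 1 u) (hmeas : ∀ t < 0, AEStronglyMeasurable (u t) volume)
    (hinv : ∀ t < 0, ∀ (x : EuclideanSpace ℝ (Fin 3)) (δ : ℝ),
      u t (x + EuclideanSpace.single 1 δ) = u t x) :
    ∀ t < 0, ∃ c : EuclideanSpace ℝ (Fin 3), u t =ᵐ[volume] fun _ => c := by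
  classical
  have hν : (0 : ℝ) < 1 := one_pos
  -- (1) gauge fixing: a jointly measurable member `ũ` of the class, `ũ t = u t + d t` a.e.
  obtain ⟨ũ, d, hsol, hjoint, -, hslice⟩ := hu.exists_stronglyMeasurable_gauge hν hmeas
  have hsl : ∀ t < 0, AEStronglyMeasurable (ũ t) volume := fun t _ =>
    (hjoint.comp_measurable measurable_prodMk_left).aestronglyMeasurable
  have hw : IsBoundedWeakNSSolutionOn (Iio 0) isOpen_Iio 1 ũ :=
    hsol.isBoundedWeakNSSolutionOn hν hjoint.aestronglyMeasurable hsl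
  -- (2) the §4 representative `ũ = U + b(t)` a.e.
  obtain ⟨U, b, hbm, hbC, hUm, hae, hsmooth, hdivU, hbd, hlip, hvort⟩ :=
    KNSS2009_regularity_boundedWeak_ancient_holds hw
  obtain ⟨C0, hC0⟩ := hbd 0
  obtain ⟨Cb, hCb⟩ := id hbC
  have hUb : ∀ t < 0, ∀ x, ‖U t x‖ ≤ C0 := fun t ht x => by
    have h := hC0 t ht x
    rwa [norm_iteratedFDeriv_zero] at h
  have hC0nn : 0 ≤ C0 := (norm_nonneg _).trans (hUb (-1) (by norm_num) 0)
  have hUc : ∀ t < 0, Continuous (U t) := fun t ht => (hsmooth t ht).continuous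
  -- at a.e. `t`, the slice `U t` is invariant along `e₁` everywhere
  have hUinv : ∀ᵐ t ∂((volume : Measure ℝ).restrict (Iio 0)),
      ∀ (x : EuclideanSpace ℝ (Fin 3)) (δ : ℝ), U t (x + EuclideanSpace.single 1 δ) = U t x := by
    filter_upwards [hae, ae_restrict_mem measurableSet_Iio] with t ht htneg
    have htneg : t < 0 := htneg
    intro x δ
    have hg : U t =ᵐ[volume] fun y => u t y + (d t - b t) := by
      filter_upwards [ht, hslice t htneg] with y hy hy'
      have h1 : U t y = ũ t y - b t := by rw [hy]; abel
      rw [h1, hy']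
      abel
    have hτ : MeasurePreserving (fun y : EuclideanSpace ℝ (Fin 3) => y + EuclideanSpace.single 1 δ)
        volume volume := measurePreserving_add_right volume _
    have h1 : (U t ∘ fun y => y + EuclideanSpace.single 1 δ) =ᵐ[volume]
        ((fun y => u t y + (d t - b t)) ∘ fun y => y + EuclideanSpace.single 1 δ) :=
      hτ.quasiMeasurePreserving.ae_eq hg
    have h2 : (U t ∘ fun y => y + EuclideanSpace.single 1 δ) =ᵐ[volume] U t := by
      refine (h1.trans (Eventually.of_forall fun y => ?_)).trans hg.symm
      simp only [Function.comp_apply, hinv t htneg]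
    have hcτ : Continuous (U t ∘ fun y => y + EuclideanSpace.single 1 δ) :=
      (hUc t htneg).comp (continuous_id.add continuous_const)
    exact congr_fun (Measure.eq_of_ae_eq h2 hcτ (hUc t htneg)) x
  -- (3) a measurable conull set of good times
  obtain ⟨T₀, hT₀m, hT₀sub, hT₀ae⟩ : ∃ T₀ : Set ℝ, MeasurableSet T₀ ∧
      (∀ t ∈ T₀, t < 0 ∧ (ũ t =ᵐ[volume] fun x => U t x + b t) ∧
        ∀ (x : EuclideanSpace ℝ (Fin 3)) (δ : ℝ), U t (x + EuclideanSpace.single 1 δ) = U t x) ∧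
      ∀ᵐ t ∂((volume : Measure ℝ).restrict (Iio 0)), t ∈ T₀ := by
    set μ : Measure ℝ := (volume : Measure ℝ).restrict (Iio 0) with hμ
    set Pg : ℝ → Prop := fun t => t < 0 ∧ (ũ t =ᵐ[volume] fun x => U t x + b t) ∧
        ∀ (x : EuclideanSpace ℝ (Fin 3)) (δ : ℝ), U t (x + EuclideanSpace.single 1 δ) = U t x with hPg
    have hgood : ∀ᵐ t ∂μ, Pg t := by
      filter_upwards [ae_restrict_mem measurableSet_Iio, hae, hUinv] with t h1 h2 h3
      exact ⟨h1, h2, h3⟩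
    have hB : μ {t | ¬ Pg t} = 0 := ae_iff.1 hgood
    refine ⟨(toMeasurable μ {t | ¬ Pg t})ᶜ, (measurableSet_toMeasurable _ _).compl, ?_, ?_⟩
    · intro t ht
      by_contra hcon
      exact ht (subset_toMeasurable μ {t | ¬ Pg t} hcon)
    · have h0 : μ (toMeasurable μ {t | ¬ Pg t}) = 0 := by rw [measure_toMeasurable]; exact hB
      exact measure_eq_zero_iff_ae_notMem.1 h0
  -- the representative modified on the null set of bad times
  set U' : ℝ → EuclideanSpace ℝ (Fin 3) → EuclideanSpace ℝ (Fin 3) :=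
    fun t => if t ∈ T₀ then U t else 0 with hU'_def
  have hU'T : ∀ t ∈ T₀, U' t = U t := fun t ht => by simp [hU'_def, ht]
  have hU'n : ∀ t ∉ T₀, U' t = 0 := fun t ht => by simp [hU'_def, ht]
  have hU'm : Measurable (uncurry U') := by
    have h1 : uncurry U' = fun p : ℝ × EuclideanSpace ℝ (Fin 3) =>
        if p.1 ∈ T₀ then U p.1 p.2 else 0 := by
      funext p
      by_cases hp : p.1 ∈ T₀
      · simp [uncurry, hU'_def, hp]
      · simp [uncurry, hU'_def, hp]
    rw [h1]
    exact Measurable.ite (measurable_fst hT₀m) hUm measurable_const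
  have hU'c : ∀ t, Continuous (U' t) := fun t => by
    by_cases ht : t ∈ T₀
    · rw [hU'T t ht]; exact hUc t (hT₀sub t ht).1
    · rw [hU'n t ht]; exact continuous_const
  have hU'b : ∀ t x, ‖U' t x‖ ≤ C0 := fun t x => by
    by_cases ht : t ∈ T₀
    · rw [hU'T t ht]; exact hUb t (hT₀sub t ht).1 x
    · rw [hU'n t ht]; simpa using hC0nn
  have hU'inv : ∀ t, ∀ (x : EuclideanSpace ℝ (Fin 3)) (δ : ℝ),
      U' t (x + EuclideanSpace.single 1 δ) = U' t x := fun t x δ => by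
    by_cases ht : t ∈ T₀
    · rw [hU'T t ht]; exact (hT₀sub t ht).2.2 x δ
    · rw [hU'n t ht]; rfl
  have hU'div : ∀ t, IsWeaklyDivFree (U' t) := fun t => by
    by_cases ht : t ∈ T₀
    · rw [hU'T t ht]
      exact VectorCalculus.IsDivFree.isWeaklyDivFree_holds (hdivU t (hT₀sub t ht).1)
        ((hsmooth t (hT₀sub t ht).1).of_le (natCast_le_contDiff_infty 1))
    · rw [hU'n t ht]
      intro θ _
      simp
  -- `w = U' + b` is a bounded weak solution (it equals `ũ` a.e. on the slab)
  set w : ℝ → EuclideanSpace ℝ (Fin 3) → EuclideanSpace ℝ (Fin 3) := fun t x => U' t x + b t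
    with hw_def
  have hwW : IsBoundedWeakNSSolutionOn (Iio 0) isOpen_Iio 1 w := by
    refine hw.congr_ae ?_ ⟨C0 + Cb, fun t _ x => ?_⟩ ?_
    · have h1 : uncurry w = fun p : ℝ × EuclideanSpace ℝ (Fin 3) => uncurry U' p + b p.1 := by
        funext p; rfl
      rw [h1]
      exact (hU'm.add (hbm.comp measurable_fst)).aestronglyMeasurable
    · exact (norm_add_le _ _).trans (add_le_add (hU'b t x) (hCb t))
    · filter_upwards [hT₀ae] with t ht
      obtain ⟨-, hũ, -⟩ := hT₀sub t ht
      have h1 : w t = fun x => U t x + b t := funext fun x => by simp [hw_def, hU'T t ht]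
      rw [h1]
      exact hũ.symm
  -- (4) descent to the plane `x₁ = 0` and Theorem 5.1
  set P : EuclideanSpace ℝ (Fin 3) →L[ℝ] EuclideanSpace ℝ (Fin 2) :=
    (EuclideanSpace.proj (0 : Fin 3)).smulRight (EuclideanSpace.single (0 : Fin 2) (1 : ℝ)) +
      (EuclideanSpace.proj (2 : Fin 3)).smulRight (EuclideanSpace.single (1 : Fin 2) (1 : ℝ))
    with hPdef
  set L : EuclideanSpace ℝ (Fin 2) →L[ℝ] EuclideanSpace ℝ (Fin 3) :=
    (EuclideanSpace.proj (0 : Fin 2)).smulRight (EuclideanSpace.single (0 : Fin 3) (1 : ℝ)) +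
      (EuclideanSpace.proj (1 : Fin 2)).smulRight (EuclideanSpace.single (2 : Fin 3) (1 : ℝ))
    with hLdef
  have hP : ∀ v : EuclideanSpace ℝ (Fin 3), P v = toLp 2 ![v 0, v 2] := by
    intro v; rw [hPdef]; ext j; fin_cases j <;> simp
  have hL : ∀ y : EuclideanSpace ℝ (Fin 2), L y = toLp 2 ![y 0, 0, y 1] := by
    intro y; rw [hLdef]; ext j; fin_cases j <;> simp
  have hwc : ∀ t ∈ Iio (0 : ℝ), Continuous (w t) := fun t _ => (hU'c t).add continuous_const
  have hwinv : ∀ t ∈ Iio (0 : ℝ), ∀ (x : EuclideanSpace ℝ (Fin 3)) (δ : ℝ),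
      w t (x + EuclideanSpace.single 1 δ) = w t x := fun t _ x δ => by
    simp only [hw_def, hU'inv t x δ]
  have hwdiv : ∀ t ∈ Iio (0 : ℝ), IsWeaklyDivFree (w t) := fun t _ => (hU'div t).add_const _
  have hVm : AEStronglyMeasurable (uncurry fun t y => P (w t (L y)))
      (volume.restrict (Iio (0 : ℝ) ×ˢ univ)) := by
    have h1 : Measurable (uncurry fun t (y : EuclideanSpace ℝ (Fin 2)) => P (w t (L y))) := by
      have hUL : Measurable fun p : ℝ × EuclideanSpace ℝ (Fin 2) => uncurry U' (p.1, L p.2) :=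
        hU'm.comp (measurable_fst.prodMk (L.continuous.measurable.comp measurable_snd))
      have hbL : Measurable fun p : ℝ × EuclideanSpace ℝ (Fin 2) => b p.1 := hbm.comp measurable_fst
      have h2 : (uncurry fun t (y : EuclideanSpace ℝ (Fin 2)) => P (w t (L y))) =
          fun p => P (uncurry U' (p.1, L p.2) + b p.1) := by
        funext p; rfl
      rw [h2]
      exact P.continuous.measurable.comp (hUL.add hbL)
    exact h1.aestronglyMeasurable
  have hV := hwW.planarProj_trace_of_lineInvariant hP hL hwc hVm hwinv hwdiv
  obtain ⟨β, -, -, hβ⟩ := KNSS2009_liouville_planar_holds hV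
  -- the planar components of `U t` are constant in space, for a.e. `t`
  have hplae : ∀ᵐ t ∂((volume : Measure ℝ).restrict (Iio 0)),
      ∀ x : EuclideanSpace ℝ (Fin 3), U t x 0 = U t 0 0 ∧ U t x 2 = U t 0 2 := by
    filter_upwards [hβ, hT₀ae] with t ht hT
    obtain ⟨htneg, -, hinvU⟩ := hT₀sub t hT
    have hwt : ∀ x, w t x = U t x + b t := fun x => by simp [hw_def, hU'T t hT]
    have h0 : (fun y : EuclideanSpace ℝ (Fin 2) => U t (L y) 0) =ᵐ[volume]
        fun _ => β t 0 - b t 0 := by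
      filter_upwards [ht] with y hy
      have := congr_arg (fun v : EuclideanSpace ℝ (Fin 2) => v 0) hy
      have h' : U t (L y) 0 + b t 0 = β t 0 := by simpa [hP, hwt] using this
      linarith
    have h2 : (fun y : EuclideanSpace ℝ (Fin 2) => U t (L y) 2) =ᵐ[volume]
        fun _ => β t 1 - b t 2 := by
      filter_upwards [ht] with y hy
      have := congr_arg (fun v : EuclideanSpace ℝ (Fin 2) => v 1) hy
      have h' : U t (L y) 2 + b t 2 = β t 1 := by simpa [hP, hwt] using this
      linarith
    have hc0 : Continuous fun y : EuclideanSpace ℝ (Fin 2) => U t (L y) 0 :=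
      (EuclideanSpace.proj (0 : Fin 3)).continuous.comp ((hUc t htneg).comp L.continuous)
    have hc2 : Continuous fun y : EuclideanSpace ℝ (Fin 2) => U t (L y) 2 :=
      (EuclideanSpace.proj (2 : Fin 3)).continuous.comp ((hUc t htneg).comp L.continuous)
    have e0 := Measure.eq_of_ae_eq h0 hc0 continuous_const
    have e2 := Measure.eq_of_ae_eq h2 hc2 continuous_const
    have key : ∀ x : EuclideanSpace ℝ (Fin 3), U t x = U t (L (toLp 2 ![x 0, x 2])) := by
      intro x
      have hx : L (toLp 2 ![x 0, x 2]) = toLp 2 ![x 0, 0, x 2] := by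
        rw [hL]; ext j; fin_cases j <;> simp
      rw [hx]
      conv_lhs => rw [eq_planarPoint_add_single_census x]
      exact hinvU _ _
    intro x
    refine ⟨?_, ?_⟩
    · rw [key x, key 0]
      have a1 := congr_fun e0 (toLp 2 ![x 0, x 2])
      have a2 := congr_fun e0 (toLp 2 ![(0 : EuclideanSpace ℝ (Fin 3)) 0, (0 : EuclideanSpace ℝ (Fin 3)) 2])
      simp only at a1 a2
      rw [a1, a2]
    · rw [key x, key 0]
      have a1 := congr_fun e2 (toLp 2 ![x 0, x 2])
      have a2 := congr_fun e2 (toLp 2 ![(0 : EuclideanSpace ℝ (Fin 3)) 0, (0 : EuclideanSpace ℝ (Fin 3)) 2])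
      simp only at a1 a2
      rw [a1, a2]
  -- (5) every `t < 0`: the increments `U(s, x) − U(s, 0)` are continuous in `s`
  obtain ⟨L1, hL1⟩ := hlip 1 le_rfl
  have hincr : ∀ x : EuclideanSpace ℝ (Fin 3), ContinuousOn (fun s => U s x - U s 0) (Iio 0) := by
    intro x
    refine continuousOn_of_norm_sub_le_mul (L := L1 * ‖x - 0‖) fun s hs s' hs' => ?_
    have hs : s < 0 := hs
    have hs' : s' < 0 := hs'
    have hd : Differentiable ℝ (U s' - U s) :=
      ((hsmooth s' hs').sub (hsmooth s hs)).differentiable (by simp)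
    have hbound : ∀ z, ‖fderiv ℝ (U s' - U s) z‖ ≤ L1 * |s' - s| := fun z => by
      rw [norm_fderiv_eq_norm_iteratedFDeriv_one,
        iteratedFDeriv_sub_apply ((hsmooth s' hs').of_le (natCast_le_contDiff_infty 1)).contDiffAt
          ((hsmooth s hs).of_le (natCast_le_contDiff_infty 1)).contDiffAt]
      exact hL1 s hs s' hs' z
    have hmv := (convex_univ (𝕜 := ℝ) (E := EuclideanSpace ℝ (Fin 3))).norm_image_sub_le_of_norm_fderiv_le
      (fun z _ => hd.differentiableAt) (fun z _ => hbound z) (mem_univ (0 : EuclideanSpace ℝ (Fin 3)))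
      (mem_univ x)
    calc ‖(U s' x - U s' 0) - (U s x - U s 0)‖ = ‖(U s' - U s) x - (U s' - U s) 0‖ := by
          congr 1; simp only [Pi.sub_apply]; abel
      _ ≤ L1 * |s' - s| * ‖x - 0‖ := hmv
      _ = L1 * ‖x - 0‖ * |s' - s| := by ring
  have hpl : ∀ t < 0, ∀ x : EuclideanSpace ℝ (Fin 3), U t x 0 = U t 0 0 ∧ U t x 2 = U t 0 2 := by
    intro t ht x
    have hc : ∀ i : Fin 3, ContinuousOn (fun s => U s x i - U s 0 i) (Iio 0) := fun i =>
      ((EuclideanSpace.proj i).continuous.comp_continuousOn (hincr x)).congr fun s _ => by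
        simp
    refine ⟨sub_eq_zero.1 (eq_of_ae_restrict_Iio_of_continuousOn (hc 0)
        (hplae.mono fun s hs => by rw [(hs x).1, sub_self]) ht),
      sub_eq_zero.1 (eq_of_ae_restrict_Iio_of_continuousOn (hc 2)
        (hplae.mono fun s hs => by rw [(hs x).2, sub_self]) ht)⟩
  -- (6) the representative is constant in space at every `t < 0`
  have hUconst := repr_const_of_planar_const hbm hbC hUm hsmooth hdivU hbd hlip hvort hpl
  -- (7) a.e. slice of `u` is a.e. constant; every slice by the continuity of the solenoidal pairings
  have hconst : ∀ᵐ t ∂((volume : Measure ℝ).restrict (Iio 0)),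
      u t =ᵐ[volume] fun _ => U t 0 + b t - d t := by
    filter_upwards [hT₀ae] with t hT
    obtain ⟨htneg, hũ, -⟩ := hT₀sub t hT
    filter_upwards [hũ, hslice t htneg] with y hy hy'
    have h1 : u t y = ũ t y - d t := by rw [hy']; abel
    rw [h1, hy, hUconst t htneg y]
  exact hu.exists_ae_eq_const_slice hν hmeas hconst

/-- **The same along an arbitrary direction `e ≠ 0`** (the class is `O(3)`-invariant — KNSS 2009, §1;
`IsBoundedAncientMildSolution.conj_linearIsometryEquiv` — so one conjugates by the reflection taking
`e/‖e‖` to `e₁`, as in `FluidPDE.apply_eq_apply_zero_of_invariant_along`): a bounded ancient mild solution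
(`ν = 1`, duality form) with a.e.-strongly measurable slices, invariant under the translations `x ↦ x + δ e`
at every `t < 0`, has every slice a.e. equal to a constant. -/
theorem ae_eq_const_of_invariant_along_of_measurable
    {u : ℝ → EuclideanSpace ℝ (Fin 3) → EuclideanSpace ℝ (Fin 3)} {e : EuclideanSpace ℝ (Fin 3)}
    (he : e ≠ 0) (hu : IsBoundedAncientMildSolution 1 u)
    (hmeas : ∀ t < 0, AEStronglyMeasurable (u t) volume)
    (hinv : ∀ t < 0, ∀ (x : EuclideanSpace ℝ (Fin 3)) (δ : ℝ), u t (x + δ • e) = u t x) :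
    ∀ t < 0, ∃ c : EuclideanSpace ℝ (Fin 3), u t =ᵐ[volume] fun _ => c := by
  set e₁ : EuclideanSpace ℝ (Fin 3) := EuclideanSpace.single 1 (1 : ℝ) with he₁_def
  set e' : EuclideanSpace ℝ (Fin 3) := ‖e‖⁻¹ • e with he'_def
  have hne : ‖e‖ ≠ 0 := norm_ne_zero_iff.2 he
  have he' : ‖e'‖ = 1 := by
    rw [he'_def, norm_smul, norm_inv, norm_norm, inv_mul_cancel₀ hne]
  have he₁ : ‖e₁‖ = 1 := by simp [he₁_def]
  set R : EuclideanSpace ℝ (Fin 3) ≃ₗᵢ[ℝ] EuclideanSpace ℝ (Fin 3) :=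
    Submodule.reflection (ℝ ∙ (e' - e₁))ᗮ with hR_def
  have hRe : R e' = e₁ := Submodule.reflection_sub (by rw [he', he₁])
  have hRsymm : R.symm e₁ = e' := by rw [← hRe, LinearIsometryEquiv.symm_apply_apply]
  set v : ℝ → EuclideanSpace ℝ (Fin 3) → EuclideanSpace ℝ (Fin 3) := fun t x => R (u t (R.symm x))
    with hv_def
  have hv : IsBoundedAncientMildSolution 1 v := hu.conj_linearIsometryEquiv R
  have hvmeas : ∀ t < 0, AEStronglyMeasurable (v t) volume := fun t ht =>
    aestronglyMeasurable_conj_linearIsometryEquiv R (hmeas t ht)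
  have hsingle : ∀ δ : ℝ, (EuclideanSpace.single 1 δ : EuclideanSpace ℝ (Fin 3)) = δ • e₁ := by
    intro δ; rw [he₁_def]; ext i; fin_cases i <;> simp
  have hvinv : ∀ t < 0, ∀ (x : EuclideanSpace ℝ (Fin 3)) (δ : ℝ),
      v t (x + EuclideanSpace.single 1 δ) = v t x := by
    intro t ht x δ
    have harg : R.symm (x + EuclideanSpace.single 1 δ) = R.symm x + (δ * ‖e‖⁻¹) • e := by
      rw [map_add, hsingle, map_smul, hRsymm, he'_def, smul_smul]
    show R (u t (R.symm (x + EuclideanSpace.single 1 δ))) = R (u t (R.symm x))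
    rw [harg, hinv t ht]
  intro t ht
  obtain ⟨c, hc⟩ := ae_eq_const_of_lineInvariant_of_measurable hv hvmeas hvinv t ht
  refine ⟨R.symm c, ?_⟩
  have h1 : (v t ∘ R) =ᵐ[volume] ((fun _ => c) ∘ R) :=
    R.measurePreserving.quasiMeasurePreserving.ae_eq hc
  filter_upwards [h1] with y hy
  simp only [Function.comp_apply, hv_def, LinearIsometryEquiv.symm_apply_apply] at hy
  rw [← hy, LinearIsometryEquiv.symm_apply_apply]

/-! ## Census row A7 is EXCLUDED-IN-TREE -/

/-- **A7 is EXCLUDED-IN-TREE**: every bounded ancient mild solution (`ν = 1`, duality form, measurable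
slices) which is `2½`-dimensional — `u(t, x + δ e₃) = u(t, x)` for all `δ`, `x`, `t < 0` — has every slice
a.e. equal to a constant (`ae_eq_const_of_invariant_along_of_measurable` with `e = e₃`; KNSS 2009 Thm 5.1 +
§4 + Lemma 2.1 through the tree's gauge fixing and descent lemmas). The census value of cell A7 flips from
EXCLUDED-IN-PRINT-NOT-TREE to EXCLUDED-IN-TREE. Nothing here bears on the general Liouville conjecture (A1). -/
theorem row_A7_excluded : Row_A7 := by
  intro u hu hmeas hinv
  have he : (EuclideanSpace.single 2 (1 : ℝ) : EuclideanSpace ℝ (Fin 3)) ≠ 0 := by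
    intro h0
    have : (EuclideanSpace.single 2 (1 : ℝ) : EuclideanSpace ℝ (Fin 3)) 2 = 0 := by rw [h0]; rfl
    simp at this
  exact ae_eq_const_of_invariant_along_of_measurable he hu hmeas hinv

end Summit.NavierStokesRegularity.NavierStokesRegularity.Theorems.ScenarioCensus

end
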